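/-
Copyright (c) 2026 the pub-hodgecm-mathlib formalisation cell (harness21).  Prover seat hodgecm-mathlib-K2E1-p12 (g0), Track B ∕ K2-LIT, h413 = `stmt-HodgeConjecture-24833`,
line `K2_E1_TraceFormulaBeta`, campaign «R8₂-sph EXHAUSTION», dealer K2E1-plan (g7) deal (136): the continued scattering scalar of `U(1,1)_{L∕L⁺}` is holomorphic on a
neighbourhood of the closed half-plane `{Re z ≥ ½}` except at `z = 1`, MODULO the functional equation — the discharge of ★ T4b's letters `hUo hUs hc hr`.
-/
import Summits.HodgeConjecture.HodgeConjecture.Theorems.K2E1PseudoEisensteinContourShiftCMTwo      -- ★ T4b p859770 (this seat): the contour shift on letters `hUo hUs hc hr hB hIP`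
import Summits.HodgeConjecture.HodgeConjecture.Theorems.K2E1SphericalConstantTermContinuationU2     -- ★ W5-B (K2E1-p13): `c̃` meromorphic on `{½ < Re}`, holomorphic off `1`, residue `r ≠ 0`, `= (ν𝓕)⁻¹∫H(w₀v)^z` on `{1 < Re}`
import Summits.HodgeConjecture.HodgeConjecture.Theorems.K2E1ScatteringUnitaryAxisCMTwo               -- ★ T2 (K2E1-p13): `‖c‖ = 1` on the axis from (FE) + reflection; the reflection symmetry from the real kernel
import Summits.HodgeConjecture.HodgeConjecture.Theorems.K2E1ConvexDiffCountableConnected             -- ★ (K2E4-p10): `countable_of_codiscrete`, `isPreconnected_convex_diff_of_countable`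
import Mathlib.Analysis.Meromorphic.NormalForm
import HarnessLib

/-!
# (136) — `K2E1ScalarUnitaryAxisContinuationCMTwo`: the scattering scalar `cI` of `U(1,1)_{L∕L⁺}` is holomorphic on an open neighbourhood of `{Re z ≥ ½}` except at `z = 1`,
# modulo the functional equation `cI(z)·cI(1−z) = 1`; the letters `hUo hUs hc hr` of ★ T4b discharged

Track B ∕ K2-LIT, crux h413 = `stmt-HodgeConjecture-24833`, route of record `HCCMUnconditional`; cell `hodgecm-mathlib`, squad K2, ENGINE E1.  THEOREMS ONLY (no `def`, no `instance`,
no `notation`, no `sorry`; default heartbeats); lane `--supports stmt-HodgeConjecture-24833 --as helper` (count-neutral).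

THE MATHEMATICS ([MoeglinWaldspurger1995, IV.1.10–IV.1.11, IV.3.12]; [Iwaniec2002, §6.3, Thm 6.6]; [Langlands1976, §7]).  INPUT = the (E3) clauses of ★ EXPORTS₂
(`K2E1SphericalEisensteinMeromorphicExportsU2Bounds.sphericalEisenstein_meromorphic_exports_cm_two`) on a pair `(P, cI)` taken as BINDERS in their exact bytes: `P ⊆ {Re ≤ 1}` closed and
co-discrete, `cI` meromorphic in normal form on `ℂ`, analytic off `P`, `cI(z) = (ν𝓕)⁻¹∫_{N(𝔸)} H(w₀v)^z dν` on `{Re z > 1}`; plus the functional-equation LETTER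
**(hFE)** `cI z · cI (1 − z) = 1` off `P ∪ (1 − P)` (payer: K2E1-p13's T2′ `K2E1ScatteringFunctionalEquationCMTwo`, B–L uniqueness).  OUTPUT:
§1 ON `{Re z > ½} ∖ {1}` THE SCALAR IS HOLOMORPHIC WITH A SIMPLE POLE AT `1` — ★ W5-B's continued scalar `c̃` agrees with `cI` on the tube, hence on the preconnected
`{½ < Re} ∖ (P ∪ {1})` (identity theorem; `P` countable ★ `countable_of_codiscrete`, ★ `isPreconnected_convex_diff_of_countable`); at a point of `P` there `cI` is meromorphic in normal form
with a finite punctured limit (`= c̃`), so of non-negative order, so ANALYTIC (Mathlib `tendsto_nhds_iff_meromorphicOrderAt_nonneg`, `MeromorphicNFAt.meromorphicOrderAt_nonneg_iff_analyticAt`);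
the residue: `(z−1)·cI(z) → r ≠ 0`.  §2 THE REFLECTION SYMMETRY `cI(conj z) = conj cI(z)` off `P ∪ conj P` (★ T2 `apply_conj_eq_conj_apply_of_tube` on the preconnected conjugation-
symmetric `(P ∪ conj⁻¹P)ᶜ ⊇ {Re > 1}`, real kernel `H(w₀v) > 0` against `(ν𝓕)⁻¹•ν`).  §3 NO POLE ON THE UNITARY AXIS: at `Re z₀ = ½` a pole would force `‖cI‖ → ∞` on the punctured
neighbourhood (`tendsto_cobounded_of_meromorphicOrderAt_neg`), while at the axis points `z₀ + it`, `t ≠ 0` small (off `P`, `1 − P`, `conj P` by co-discreteness) `1 − z = conj z` and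
(FE) + §2 give `‖cI z‖ = 1` (★ T2 `norm_eq_one_of_mul_one_sub_eq_one`) — contradiction; so `cI` is ANALYTIC at every axis point.  §4 HEAD
**`exists_isOpen_differentiableOn_of_fe`**: `∃ U` open `⊇ {Re z ≥ ½}` with `cI` complex-differentiable on `U ∖ {1}` (`U = {analytic points} ∪ {Re > ½}`), together with the residue clause —
EXACTLY ★ T4b's letters `hUo hUs hc hr` for EVERY `σ₀`; and the DISCHARGE **`pseudoEisenstein_contourShift_of_fe`**: ★ T4b's head with those four letters replaced by (E3) + (hFE)
(remaining letters: `hFE`; `hB` = T1 ★ p859417's bytes on `cI`; `hIP` = ★ FILE D's head rewritten with `(ν𝓕)⁻¹·c = cI` on the line `Re = σ₀`).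
HONEST LABEL: HC_CM is proved only modulo the 7 printed citations (2 remaining named inputs: hLiu418 = `stmt-HodgeConjecture-24832`, h413 = `stmt-HodgeConjecture-24833`) until rung 0
closes; this file asserts no named fact, closes no socket; count-neutral; letters `hFE` (+ `hB`, `hIP` in the discharge corollary).

## References
* [MoeglinWaldspurger1995] C. Mœglin, J.-L. Waldspurger, *Spectral decomposition and Eisenstein series* (1995), IV.1.10–IV.1.11, IV.3.12.
* [Iwaniec2002] H. Iwaniec, *Spectral Methods of Automorphic Forms* (2nd ed., 2002), §6.3, Thm 6.6.
* [Langlands1976] R. P. Langlands, *On the Functional Equations Satisfied by Eisenstein Series*, LNM 544 (1976), §7.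
-/

set_option autoImplicit false
set_option linter.dupNamespace false  -- the mandated namespace repeats the summit's segment (`HodgeConjecture.HodgeConjecture`)

noncomputable section

open MeasureTheory Measure Set Filter Topology Complex NumberField
open scoped Real NNReal ENNReal ComplexConjugate
open Literature.NumberTheory.Automorphic Literature.NumberTheory.Automorphic.UnitaryGroup AdelicGroupData
open Summit.HodgeConjecture.HodgeConjecture.Cruxes.H413.K2E1SphericalConstantTermContinuationU2 (sphericalConstantTerm_continuation)
open Summit.HodgeConjecture.HodgeConjecture.Cruxes.H413.K2E1ScatteringUnitaryAxisCMTwo (norm_eq_one_of_mul_one_sub_eq_one apply_conj_eq_conj_apply_of_tube)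
open Summit.HodgeConjecture.HodgeConjecture.Cruxes.H413.K2E1ConvexDiffCountableConnected (countable_of_codiscrete isPreconnected_convex_diff_of_countable)
open Summit.HodgeConjecture.HodgeConjecture.Cruxes.H413.K2E1PseudoEisensteinContourShiftCMTwo (pseudoEisenstein_contourShift_of_letters)

namespace Summit.HodgeConjecture.HodgeConjecture.Cruxes.H413.K2E1ScalarUnitaryAxisContinuationCMTwo

variable (L : Type) [Field L] [NumberField L] [IsCMField L]
variable [MeasurableSpace (quasiSplit (↥(maximalRealSubfield L)) L (IsCMField.complexConj L) 2).Adelic] [BorelSpace (quasiSplit (↥(maximalRealSubfield L)) L (IsCMField.complexConj L) 2).Adelic]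

/-! ## §0 A generic fact: co-discreteness pulled back along `z ↦ 1 − z`, `z ↦ conj z` -/

/-- Co-discreteness of `P` at `1 − z₀` and `conj z₀` pulls back to `𝓝[≠] z₀`: eventually `1 − s ∉ P` and `conj s ∉ P`. [folklore] -/
theorem eventually_one_sub_notMem_and_conj_notMem {P : Set ℂ} (hPcd : ∀ z₀ : ℂ, ∀ᶠ s in 𝓝[≠] z₀, s ∉ P) (z₀ : ℂ) :
    ∀ᶠ s in 𝓝[≠] z₀, 1 - s ∉ P ∧ conj s ∉ P := by
  have h1 : Tendsto (fun s : ℂ => 1 - s) (𝓝[≠] z₀) (𝓝[≠] (1 - z₀)) :=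
    (continuous_const.sub continuous_id).continuousWithinAt.tendsto_nhdsWithin fun s hs h => hs (sub_right_injective h)
  have h2 : Tendsto (fun s : ℂ => conj s) (𝓝[≠] z₀) (𝓝[≠] (conj z₀)) :=
    continuous_conj.continuousWithinAt.tendsto_nhdsWithin fun s hs h => hs (by simpa using congrArg conj h)
  exact (h1.eventually (hPcd (1 - z₀))).and (h2.eventually (hPcd (conj z₀)))

section Scalar

variable (ν : Measure ↥(adelicUnipotent (↥(maximalRealSubfield L)) L (IsCMField.complexConj L) 2)) [ν.IsHaarMeasure]
  {𝓕 : Set ↥(adelicUnipotent (↥(maximalRealSubfield L)) L (IsCMField.complexConj L) 2)}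
  (h𝓕N : IsFundamentalDomain ↥(rationalUnipotent (↥(maximalRealSubfield L)) L (IsCMField.complexConj L) 2) 𝓕 ν) (h𝓕c : IsCompact (closure 𝓕))
  {P : Set ℂ} {cI : ℂ → ℂ}
  (hPc : IsClosed P) (hPcd : ∀ z₀ : ℂ, ∀ᶠ s in 𝓝[≠] z₀, s ∉ P) (hPre : ∀ z ∈ P, z.re ≤ 1)
  (hcNF : MeromorphicNFOn cI univ) (hcan : ∀ z : ℂ, z ∉ P → AnalyticAt ℂ cI z)
  (hcc : ∀ z : ℂ, 1 < z.re → cI z = ((((ν 𝓕).toReal⁻¹ : ℝ)) : ℂ) * (∫ v : ↥(adelicUnipotent (↥(maximalRealSubfield L)) L (IsCMField.complexConj L) 2),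
    (((borelHeight ((quasiSplit (↥(maximalRealSubfield L)) L (IsCMField.complexConj L) 2).toAdelic (weylLongU ((IsCMField.complexConj L : L ≃ₐ[↥(maximalRealSubfield L)] L) : L →+* L)
      (rfl : (StdForm.antidiagonal 2).over L = (StdForm.antidiagonal 2).over L)) * (v : (quasiSplit (↥(maximalRealSubfield L)) L (IsCMField.complexConj L) 2).Adelic)) : ℝ) : ℂ) ^ z) ∂ν))

/-! ## §1 On `{Re z > ½} ∖ {1}`: holomorphy and the simple pole at `1` (★ W5-B transferred to `cI`) -/

include h𝓕N h𝓕c hPcd hPre hcNF hcan hcc in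
/-- **`cI` IS ANALYTIC ON `{Re z > ½} ∖ {1}` AND `(z−1)·cI(z) → r ≠ 0`.**  ★ W5-B's `c̃` is holomorphic on `{½ < Re} ∖ {1}` and equals `cI` on the tube `{1 < Re}` (both are
`(ν𝓕)⁻¹∫H(w₀v)^z dν`), hence on the preconnected open set `{½ < Re} ∖ (P ∪ {1})` (identity theorem); at `p ∈ P`, `½ < Re p`, `p ≠ 1`, the normal-form meromorphic `cI` has the finite
punctured limit `c̃ p`, so non-negative order, so it is analytic; the residue transfers along `cI =ᶠ[𝓝[≠] 1] c̃`. [cite: MoeglinWaldspurger1995, IV.1.11] -/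
theorem analyticAt_of_half_lt_re_and_residue :
    (∀ z : ℂ, 1 / 2 < z.re → z ≠ 1 → AnalyticAt ℂ cI z) ∧ ∃ r : ℂ, r ≠ 0 ∧ Tendsto (fun z : ℂ => (z - 1) * cI z) (𝓝[≠] 1) (𝓝 r) := by
  -- a nonzero trace-zero element of `L` (the `δ` of ★ W5-B; cf. ★ `Weil1982.UnitaryFinTopForm.exists_complexConj_eq_neg_ne_zero`, not imported to keep the import cone small)
  obtain ⟨δ, hcδ, hδ⟩ : ∃ δ : L, IsCMField.complexConj L δ = -δ ∧ δ ≠ 0 := by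
    obtain ⟨e, he⟩ : ∃ e : L, IsCMField.complexConj L e ≠ e := by
      by_contra hne
      exact IsCMField.complexConj_ne_one L (AlgEquiv.ext fun x => not_ne_iff.mp (not_exists.mp hne x))
    exact ⟨e - IsCMField.complexConj L e, by rw [map_sub, IsCMField.complexConj_apply_apply, neg_sub], sub_ne_zero.2 (Ne.symm he)⟩
  obtain ⟨c, r, hr0, -, hcd, hres, hceq⟩ := sphericalConstantTerm_continuation L hcδ hδ ν h𝓕N h𝓕c
  -- the domain `W = {½ < Re} ∖ (P ∪ {1})`: open, preconnected; both functions analytic there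
  have hHo : IsOpen {z : ℂ | 1 / 2 < z.re} := isOpen_lt continuous_const continuous_re
  have hH1o : IsOpen ({z : ℂ | 1 / 2 < z.re} \ {1}) := hHo.sdiff isClosed_singleton
  have hPcount : (P ∪ {1}).Countable := (countable_of_codiscrete hPcd).union (countable_singleton 1)
  have hWpre : IsPreconnected ({z : ℂ | 1 / 2 < z.re} \ (P ∪ {1})) :=
    isPreconnected_convex_diff_of_countable Literature.Topology.Euclidean.one_lt_rank_real_complex (convex_halfSpace_re_gt (1 / 2)) hHo hPcount
  have hcan' : AnalyticOnNhd ℂ c ({z : ℂ | 1 / 2 < z.re} \ (P ∪ {1})) :=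
    (hcd.analyticOnNhd hH1o).mono fun z hz => ⟨hz.1, fun h => hz.2 (Or.inr h)⟩
  have hcIan : AnalyticOnNhd ℂ cI ({z : ℂ | 1 / 2 < z.re} \ (P ∪ {1})) := fun z hz => hcan z fun h => hz.2 (Or.inl h)
  -- they agree near `2`
  have h2W : (2 : ℂ) ∈ {z : ℂ | 1 / 2 < z.re} \ (P ∪ {1}) := by
    refine ⟨by norm_num, fun h => ?_⟩
    rcases h with h | h
    · have := hPre 2 h; norm_num at this
    · norm_num at h
  have hev : cI =ᶠ[𝓝 (2 : ℂ)] c := by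
    filter_upwards [(isOpen_lt continuous_const continuous_re).mem_nhds (show (2 : ℂ) ∈ {z : ℂ | 1 < z.re} by norm_num)] with z hz
    rw [hcc z hz, hceq z hz]
  have hEq : EqOn cI c ({z : ℂ | 1 / 2 < z.re} \ (P ∪ {1})) := hcIan.eqOn_of_preconnected_of_eventuallyEq hcan' hWpre h2W hev
  -- punctured neighbourhoods of points of the open half-plane (≠ 1) lie in `W` eventually
  have hevW : ∀ p : ℂ, 1 / 2 < p.re → ∀ᶠ s in 𝓝[≠] p, s ≠ 1 → cI s = c s := by
    intro p hp
    filter_upwards [hPcd p, mem_nhdsWithin_of_mem_nhds (hHo.mem_nhds hp)] with s hsP hsH hs1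
    exact hEq ⟨hsH, fun h => h.elim hsP hs1⟩
  refine ⟨fun p hp hp1 => ?_, ⟨r, hr0, ?_⟩⟩
  · -- analyticity at `p`: finite punctured limit `c p`
    have hlim : Tendsto cI (𝓝[≠] p) (𝓝 (c p)) := by
      have hcont : ContinuousAt c p := (hcd.differentiableAt (hH1o.mem_nhds ⟨hp, hp1⟩)).continuousAt
      have hne1 : ∀ᶠ s in 𝓝[≠] p, s ≠ 1 := mem_nhdsWithin_of_mem_nhds (isOpen_ne.mem_nhds hp1)
      refine (tendsto_nhdsWithin_of_tendsto_nhds hcont.tendsto).congr' ?_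
      filter_upwards [hevW p hp, hne1] with s hs hs1
      exact (hs hs1).symm
    have hNF : MeromorphicNFAt cI p := hcNF (mem_univ p)
    exact hNF.meromorphicOrderAt_nonneg_iff_analyticAt.1 ((tendsto_nhds_iff_meromorphicOrderAt_nonneg hNF.meromorphicAt).1 ⟨c p, hlim⟩)
  · -- the residue transfers
    refine hres.congr' ?_
    filter_upwards [hevW 1 (by norm_num), self_mem_nhdsWithin] with s hs hs1
    rw [hs hs1]

/-! ## §2 The reflection symmetry `cI (conj z) = conj (cI z)` off `P ∪ conj P` -/

omit [BorelSpace (quasiSplit (↥(maximalRealSubfield L)) L (IsCMField.complexConj L) 2).Adelic] [ν.IsHaarMeasure] in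
include hPc hPcd hPre hcan hcc in
/-- **`cI(conj z) = conj cI(z)` whenever `z, conj z ∉ P`** — ★ T2 `apply_conj_eq_conj_apply_of_tube` on the open, preconnected (complement of a countable set), conjugation-symmetric
`V = (P ∪ conj⁻¹P)ᶜ ⊇ {Re > 1}`, with the positive real kernel `H(w₀v)` against `(ν𝓕)⁻¹ • ν`. [cite: MoeglinWaldspurger1995, IV.1.10] [cite: Langlands1976, §7] -/
theorem apply_conj_eq_conj_apply {z : ℂ} (hz : z ∉ P) (hz' : conj z ∉ P) : cI (conj z) = conj (cI z) := by
  set V : Set ℂ := (P ∪ {w : ℂ | conj w ∈ P})ᶜ with hV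
  have hVo : IsOpen V := (hPc.union (hPc.preimage continuous_conj)).isOpen_compl
  have hconjP : {w : ℂ | conj w ∈ P} = (starRingEnd ℂ) '' P := by
    ext w
    refine ⟨fun h => ⟨conj w, h, conj_conj w⟩, ?_⟩
    rintro ⟨u, hu, rfl⟩
    show conj (conj u) ∈ P
    rwa [conj_conj]
  have hVcount : (P ∪ {w : ℂ | conj w ∈ P}).Countable := (countable_of_codiscrete hPcd).union (by rw [hconjP]; exact (countable_of_codiscrete hPcd).image _)
  have hVpre : IsPreconnected V := by
    have e : V = univ \ (P ∪ {w : ℂ | conj w ∈ P}) := by ext w; simp [hV]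
    rw [e]
    exact isPreconnected_convex_diff_of_countable Literature.Topology.Euclidean.one_lt_rank_real_complex convex_univ isOpen_univ hVcount
  have hVsym : ∀ w ∈ V, conj w ∈ V := fun w hw h => hw (by
    rcases h with h | h
    · exact Or.inr h
    · rw [mem_setOf_eq, conj_conj] at h; exact Or.inl h)
  have hVtube : {w : ℂ | 1 < w.re} ⊆ V := fun w hw h => by
    rcases h with h | h
    · have := hPre w h; simp only [mem_setOf_eq] at hw; linarith
    · have := hPre _ h; rw [conj_re] at this; simp only [mem_setOf_eq] at hw; linarith
  have hcV : DifferentiableOn ℂ cI V := fun w hw => (hcan w fun h => hw (Or.inl h)).differentiableAt.differentiableWithinAt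
  have hpos : ∀ v : ↥(adelicUnipotent (↥(maximalRealSubfield L)) L (IsCMField.complexConj L) 2),
      (0 : ℝ) < (borelHeight ((quasiSplit (↥(maximalRealSubfield L)) L (IsCMField.complexConj L) 2).toAdelic (weylLongU ((IsCMField.complexConj L : L ≃ₐ[↥(maximalRealSubfield L)] L) : L →+* L)
        (rfl : (StdForm.antidiagonal 2).over L = (StdForm.antidiagonal 2).over L)) * (v : (quasiSplit (↥(maximalRealSubfield L)) L (IsCMField.complexConj L) 2).Adelic)) : ℝ) :=
    fun v => by exact_mod_cast borelHeight_pos _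
  set μ' : Measure ↥(adelicUnipotent (↥(maximalRealSubfield L)) L (IsCMField.complexConj L) 2) := (ν 𝓕)⁻¹ • ν with hμ'
  have hceq' : ∀ w : ℂ, 1 < w.re → cI w = ∫ v : ↥(adelicUnipotent (↥(maximalRealSubfield L)) L (IsCMField.complexConj L) 2),
      ((borelHeight ((quasiSplit (↥(maximalRealSubfield L)) L (IsCMField.complexConj L) 2).toAdelic
        (weylLongU ((IsCMField.complexConj L : L ≃ₐ[↥(maximalRealSubfield L)] L) : L →+* L) (rfl : (StdForm.antidiagonal 2).over L = (StdForm.antidiagonal 2).over L)) *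
          (v : (quasiSplit (↥(maximalRealSubfield L)) L (IsCMField.complexConj L) 2).Adelic)) : ℝ) : ℂ) ^ w ∂μ' := by
    intro w hw
    rw [hμ', integral_smul_measure, ENNReal.toReal_inv, RCLike.real_smul_eq_coe_mul]
    exact hcc w hw
  exact apply_conj_eq_conj_apply_of_tube hVo hVpre hVsym hVtube hcV μ' hpos hceq' z (fun h => h.elim hz hz')

/-! ## §3 No pole on the unitary axis -/

omit [BorelSpace (quasiSplit (↥(maximalRealSubfield L)) L (IsCMField.complexConj L) 2).Adelic] [ν.IsHaarMeasure] in
include hPc hPcd hPre hcNF hcan hcc in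
/-- **`cI` IS ANALYTIC AT EVERY POINT OF THE UNITARY AXIS `Re z = ½`, MODULO (FE).**  Were `z₀` a pole, `‖cI‖ → ∞` on `𝓝[≠] z₀` (normal form, negative order); but along the axis
`z₀ + it`, `t ≠ 0` small, the points avoid `P`, `1 − P`, `conj P` (co-discreteness), `1 − z = conj z`, and (FE) with §2 gives `‖cI z‖ = 1` (★ T2 `norm_eq_one_of_mul_one_sub_eq_one`).
[cite: MoeglinWaldspurger1995, IV.3.12] [cite: Iwaniec2002, Thm 6.6] -/
theorem analyticAt_of_re_eq_half (hFE : ∀ z : ℂ, z ∉ P → 1 - z ∉ P → cI z * cI (1 - z) = 1) {z₀ : ℂ} (hz₀ : z₀.re = 1 / 2) : AnalyticAt ℂ cI z₀ := by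
  have hNF : MeromorphicNFAt cI z₀ := hcNF (mem_univ z₀)
  by_contra hna
  have hneg : meromorphicOrderAt cI z₀ < 0 := lt_of_not_ge fun h => hna (hNF.meromorphicOrderAt_nonneg_iff_analyticAt.1 h)
  have hinf : Tendsto (fun s => ‖cI s‖) (𝓝[≠] z₀) atTop := tendsto_norm_atTop_iff_cobounded.2 (tendsto_cobounded_of_meromorphicOrderAt_neg hneg)
  -- eventually on the punctured neighbourhood: large norm, and off `P`, `1 − P`, `conj P`
  have hev : ∀ᶠ s in 𝓝[≠] z₀, 2 ≤ ‖cI s‖ ∧ s ∉ P ∧ (1 - s ∉ P ∧ conj s ∉ P) :=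
    (hinf.eventually (eventually_ge_atTop 2)).and ((hPcd z₀).and (eventually_one_sub_notMem_and_conj_notMem hPcd z₀))
  -- push along the axis `t ↦ z₀ + it`
  have hpath : Tendsto (fun t : ℝ => z₀ + (t : ℂ) * I) (𝓝[≠] 0) (𝓝[≠] z₀) := by
    have hc : Continuous fun t : ℝ => z₀ + (t : ℂ) * I := continuous_const.add (continuous_ofReal.mul continuous_const)
    have h1 : Tendsto (fun t : ℝ => z₀ + (t : ℂ) * I) (𝓝[≠] 0) (𝓝 z₀) := by
      have h := hc.tendsto 0
      simp only [ofReal_zero, zero_mul, add_zero] at h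
      exact tendsto_nhdsWithin_of_tendsto_nhds h
    refine tendsto_nhdsWithin_iff.2 ⟨h1, eventually_mem_nhdsWithin.mono fun t ht h => ht ?_⟩
    have h' := congrArg Complex.im h
    simpa using h'
  obtain ⟨t, ⟨hnorm, htP, ht1P, htcP⟩⟩ := (hpath.eventually hev).exists
  -- on the axis `1 − z = conj z`, so (FE) + reflection give `‖cI z‖ = 1`
  have hre : (z₀ + (t : ℂ) * I).re = 1 / 2 := by simp [hz₀]
  have hsym := apply_conj_eq_conj_apply L ν hPc hPcd hPre hcan hcc htP htcP
  have h1 := norm_eq_one_of_mul_one_sub_eq_one (hFE _ htP ht1P) hsym hre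
  linarith

/-! ## §4 HEAD: the open neighbourhood of `{Re z ≥ ½}`, and the discharge of ★ T4b's letters -/

include h𝓕N h𝓕c hPc hPcd hPre hcNF hcan hcc in
/-- **HEAD — THE CONTINUED SCATTERING SCALAR IS HOLOMORPHIC ON A NEIGHBOURHOOD OF `{Re z ≥ ½}` EXCEPT AT `z = 1`, MODULO (FE).**  From the (E3) binders and the functional-equation letter:
`∃ U` open with `{z | ½ ≤ Re z} ⊆ U` and `cI` complex-differentiable on `U ∖ {1}` (`U = {analytic points of cI} ∪ {Re > ½}`: §3 on the axis, §1 to its right), and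
`∃ r ≠ 0, (z−1)·cI(z) → r` — ★ T4b's letters `hUo hUs hc hr` for EVERY `σ₀ > 1` at once. [cite: MoeglinWaldspurger1995, IV.1.11, IV.3.12] -/
theorem exists_isOpen_differentiableOn_of_fe (hFE : ∀ z : ℂ, z ∉ P → 1 - z ∉ P → cI z * cI (1 - z) = 1) :
    (∃ U : Set ℂ, IsOpen U ∧ {z : ℂ | 1 / 2 ≤ z.re} ⊆ U ∧ DifferentiableOn ℂ cI (U \ {1})) ∧
      ∃ r : ℂ, r ≠ 0 ∧ Tendsto (fun z : ℂ => (z - 1) * cI z) (𝓝[≠] 1) (𝓝 r) := by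
  obtain ⟨hright, hres⟩ := analyticAt_of_half_lt_re_and_residue L ν h𝓕N h𝓕c hPcd hPre hcNF hcan hcc
  refine ⟨⟨{z : ℂ | AnalyticAt ℂ cI z} ∪ {z : ℂ | 1 / 2 < z.re}, isOpen_analyticAt ℂ cI |>.union (isOpen_lt continuous_const continuous_re), fun z hz => ?_, fun z hz => ?_⟩, hres⟩
  · rcases lt_or_eq_of_le (show (1 / 2 : ℝ) ≤ z.re from hz) with h | h
    · exact Or.inr h
    · exact Or.inl (analyticAt_of_re_eq_half L ν hPc hPcd hPre hcNF hcan hcc hFE h.symm)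
  · have hz1 : z ≠ 1 := hz.2
    rcases hz.1 with h | h
    · exact h.differentiableAt.differentiableWithinAt
    · exact (hright z h hz1).differentiableAt.differentiableWithinAt

include h𝓕N h𝓕c hPc hPcd hPre hcNF hcan hcc in
/-- **THE DISCHARGE OF ★ T4b (`pseudoEisenstein_contourShift_of_letters`) MODULO (FE)**: for `f, f′ ∈ C²_c((0,∞))`, `σ₀ > 1`, the T1 bound `hB` (★ p859417's bytes on `cI`) and the
inner-product identity `hIP : IP = C·((2π)⁻¹∫_ℝ F(σ₀+iy) dy)` with integrand `F(z) = f̃(z)·(conj f̃′(1−z̄) + cI(z)·conj f̃′(z̄))` (★ FILE D's head after `(ν𝓕)⁻¹·∫H^z = cI z` on the line):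
**`∃ r ≠ 0` with `(z−1)cI(z) → r` and `IP = C·(r·f̃(1)·conj f̃′(1)) + C·((2π)⁻¹∫_ℝ F(½+iy) dy)`.** [cite: MoeglinWaldspurger1995, II.2.1, II.2.4, IV.3.12] -/
theorem pseudoEisenstein_contourShift_of_fe (hFE : ∀ z : ℂ, z ∉ P → 1 - z ∉ P → cI z * cI (1 - z) = 1)
    {f f' : ℝ → ℂ} (hf : ContDiff ℝ 2 f) (hfs : HasCompactSupport f) (hf0 : tsupport f ⊆ Ioi 0)
    (hf' : ContDiff ℝ 2 f') (hf's : HasCompactSupport f') (hf'0 : tsupport f' ⊆ Ioi 0) {σ₀ : ℝ} (hσ₀ : 1 < σ₀)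
    {B : ℝ} (hB : ∀ z : ℂ, 1 / 2 < z.re → z.re ≤ σ₀ → 1 ≤ |z.im| → ‖cI z‖ ≤ B)
    {IP C : ℂ} (hIP : IP = C * ((((2 * π)⁻¹ : ℝ) : ℂ) * ∫ y : ℝ, mellin f (-((σ₀ : ℂ) + y * I)) *
      (conj (mellin f' (-(1 - conj ((σ₀ : ℂ) + y * I)))) + cI ((σ₀ : ℂ) + y * I) * conj (mellin f' (-conj ((σ₀ : ℂ) + y * I)))))) :
    ∃ r : ℂ, r ≠ 0 ∧ Tendsto (fun z : ℂ => (z - 1) * cI z) (𝓝[≠] 1) (𝓝 r) ∧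
      IP = C * (r * (mellin f (-1) * conj (mellin f' (-1)))) +
        C * ((((2 * π)⁻¹ : ℝ) : ℂ) * ∫ y : ℝ, mellin f (-((((1 / 2 : ℝ)) : ℂ) + y * I)) *
          (conj (mellin f' (-(1 - conj ((((1 / 2 : ℝ)) : ℂ) + y * I)))) + cI ((((1 / 2 : ℝ)) : ℂ) + y * I) * conj (mellin f' (-conj ((((1 / 2 : ℝ)) : ℂ) + y * I))))) := by
  obtain ⟨⟨U, hUo, hUs, hc⟩, r, hr0, hr⟩ := exists_isOpen_differentiableOn_of_fe L ν h𝓕N h𝓕c hPc hPcd hPre hcNF hcan hcc hFE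
  refine ⟨r, hr0, hr, ?_⟩
  have hUs' : {z : ℂ | 1 / 2 ≤ z.re ∧ z.re ≤ σ₀} ⊆ U := fun z hz => hUs hz.1
  have hIP' : IP = C * ((((2 * π)⁻¹ : ℝ) : ℂ) * ∫ y : ℝ, mellin f (-((σ₀ : ℂ) + y * I)) *
      (conj (mellin f' (-(1 - conj ((σ₀ : ℂ) + y * I)))) + ((1 : ℝ) : ℂ) * cI ((σ₀ : ℂ) + y * I) * conj (mellin f' (-conj ((σ₀ : ℂ) + y * I))))) := by
    simpa only [ofReal_one, one_mul] using hIP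
  have h := pseudoEisenstein_contourShift_of_letters hf hfs hf0 hf' hf's hf'0 hσ₀ 1 hUo hUs' hc hr hB hIP'
  simpa only [ofReal_one, one_mul] using h

end Scalar

end Summit.HodgeConjecture.HodgeConjecture.Cruxes.H413.K2E1ScalarUnitaryAxisContinuationCMTwo

end
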